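import Literature.NumberTheory.EllipticCurves.TianYuanZhang2017.UPlusOfGenusPointData
import HarnessLib
import HarnessLib.Audit.Tags

/-!
# Cell «bsd-monsky» (prover-B): route B's ONE DISPLAY — PROOF-B's `θ`-package (the lift of `σ_{1+ϖ}`) on the
# Tian–Yuan–Zhang genus-point data, and the action of such a `θ` on `A(ℍ′_N)` — DEFINITIONS, nothing asserted

HONEST FRAMING (cell `bsd-monsky`, run/shared/lean/pub/bsd-monsky/; README §1: ONE theorem on ONE explicit family of
quadratic twists at the prime `2`; nothing is booked until the cross-family referee passes the written proofs). This file
asserts NO arithmetic fact: it defines the action `thetaPt` of an automorphism `θ ∈ Aut(ℍ′_n/ℚ)` on the `ℍ′_n`-points of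
TYZ's curve `A` (and of `A₂ ≅_ℚ E`), proves the elementary identities the kernel needs (`θ[i] = −[i]θ` when
`θ(i) = −i`; `θ` fixes `τ(1)`, `τ(1/2)` and negates `τ(i/2)`; `θ` fixes the image of `A₂(K_n)` when `θ(√−n) = √−n`;
`φ ∘ θ = θ ∘ φ`), and DISPLAYS as a predicate `thetaSpec D θ` on the data `D : GenusPointData (2pq)` of the tree's
Tian–Yuan–Zhang display (`Literature/…/TianYuanZhang2017/GenusPointDescentDisplays.lean`) the `θ`-PACKAGE of the
cell's second, independent proof:

PROOF-B (`HOME/proof/PROOF-B.md`, prover-B; v1.1 PASSED the cross-family referee 2026-08-25, `HOME/REFEREE-VERDICT-B.md`;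
v1.2 = two locator-range fixes). THEOREM B: `p ≡ 5 (mod 8)`, `q ≡ 3 (mod 4)` primes, `N = 2pq`, `g(N)` odd ⟹ `𝓛(N)` odd.
Its mechanism is ONE new descent operator: `θ` := (the restriction to `ℍ′_N` of) any lift of the GENERATOR `σ_{1+ϖ}` of
`Gal(H′_N/H_N) ≅ ℤ/4` (TYZ Prop. 3.2 (2); `H′_N` = ring class field of conductor `4` of `K_N = ℚ(√−2pq)`), in place
of TYZ's `β = r_∞(−1)r₂(−2 or 6)`. By class field theory `θ|_{ℚ(i,√2,√p,√q)} = r₂(1 + N) = r₂(7)`: it inverts `i`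
and `√q`, fixes `√2` and `√p` (PROOF-B Lemma 4); hence (Lemma 5) `(θ − 1)Z(N) = g(N)·w` with
`w = z_N^{σ_{1+ϖ}} − z_N ∈ A(ℚ(i))`, `w + w̄ = τ(1)` (TYZ Thm. 3.6 (2): `w = τ((1−i)/2)`), `θ` FIXES the sub-block
`Z(pq) ∈ A(ℚ(√p, √−q))` (`q ≡ 3 (8)`) resp. `Z(q) ∈ A(ℚ(√−q))` (`q ≡ 7 (8)`), and `θZ(p) ∈ −Z(p) + ℤτ(1)`
(`θ = c·x`, `x ∈ 2Cl′_p`, TYZ Thm. 3.6 (1)). §2 below types exactly these conclusions ((θ0)–(θ2), (B0)–(B3)) as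
`thetaSpec`, and the HYPOTHESIS PACKAGE `thetaGenusPointDatum p q` ("there are TYZ data `D` for `2pq` with `D.Printed` AND a `θ`
with `thetaSpec D θ`", taken for all such `(p, q)`), tagged `@[conjecture]` = an obligation node of the tree: it is NOT a
printed statement of [TianYuanZhang2017] and NOT a Literature fact — it is the KERNEL DEBT `K_B` of route B, whose
discharge is a display of TYZ Prop. 3.2 / Thm. 3.6 WITH the CM points `z_n`, the class-group action and the Artin map,
followed by PROOF-B's Galois bookkeeping in the kernel (the analogue of the typer's `K1` for route A, `HOME/lean/PLAN.md`).
The companion file `P2/CongruentNumberSilentEvenFiveThetaDescent.lean` proves THEOREM B in the kernel from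
`D.Printed ∧ thetaSpec D θ` + GZK (reusing W2's `E`-side transfer verbatim) and feeds C-P2-1 through the landed doors.

What the cross-readers should check: (θ2) is displayed as the SET statement `(θ − 1)A(ℍ′_N)[4] ⊆ ℤτ(i/2)` (PROOF-B
(T-c) on `A`: `(c−1)τ(x) = τ(x̄ − x) ∈ τ((i/2)ℤ)`; `A(ℍ′_N)_tor = A[4]` is TYZ Lemma 3.18, displayed), which is what
the kernel consumes and is invariant under the display's two WLOG normalisations (`τ(1/2) = (2, ±4)`, `im = ±i`) and
under `Z ↦ −Z`; (B1) carries `+ ℤτ(1)` although PROOF-B proves it on the nose; (B0) is `w ∈ A[(1+i)³]` (`2w ∈ {0, τ(1)}`)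
`∧ θw + w = τ(1)` (`θ = c` on `A(ℚ(i))` by (θ1)). Nothing booked; no mark moved.

References: HOME/proof/PROOF-B.md §2.2 (T-a)–(T-c), §7 (Lemmas 4, 5), §8, §12 R1; [TianYuanZhang2017] Prop. 3.2, Thm. 3.3,
Thm. 3.5, Thm. 3.6, Lemmas 3.16, 3.18, §3.1 (chunks p0010–p0012, p0017, p0020 as cited inline); [Tian2014] §2 (the curve
`A`, `τ`); HOME/lean/PLAN.md (typer).
-/

noncomputable section

open scoped Classical

open WeierstrassCurve WeierstrassCurve.Affine NumberField Literature.NumberTheory.EllipticCurves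
  Literature.NumberTheory.EllipticCurves.TianYuanZhang2017
  Literature.NumberTheory.EllipticCurves.TianYuanZhang2017.W2

set_option autoImplicit false

namespace Summit.BirchSwinnertonDyer.Rank1Residual.P2

namespace ThetaDescent

variable {n : ℕ}

/-! ## §1 An automorphism `θ ∈ Aut(ℍ′_n/ℚ)` acting on `A(ℍ′_n)` and `A₂(ℍ′_n)`; `θ(i) = −i` versus `[i]` -/

/-- `θ` acting on `A(ℍ′_n)` (the standard action `R ↦ R^θ` of `θ ∈ Aut(ℍ′_n/ℚ)` on the `ℍ′_n`-points of the
`ℚ`-curve `A`), an additive map. [cite: TianYuanZhang2017, proof of Thm. 3.5 (2) (p0020 L22–L24)] -/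
def thetaPt (D : GenusPointData n) (θ : D.H ≃ₐ[ℚ] D.H) : APoint D.H →+ APoint D.H :=
  Point.map (W' := curveA) θ.toAlgHom

/-- `θ` acting on `A₂(ℍ′_n)` (`A₂ = Y² = X³ − 16X ≅_ℚ E`). [cite: TianYuanZhang2017, proof of Thm. 3.5 (2) (p0020 L22–L24)] -/
def thetaPtE (D : GenusPointData n) (θ : D.H ≃ₐ[ℚ] D.H) : A2Point D.H →+ A2Point D.H :=
  Point.map (W' := curveA.twoIsogenyCodomain) θ.toAlgHom

/-- `φ_H ∘ θ = θ ∘ φ_H`: the `2`-isogeny `φ : A → A₂` is defined over `ℚ`. [cite: TianYuanZhang2017, Thm. 3.5 (1) (p0011 L98)] -/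
theorem φH_thetaPt (D : GenusPointData n) (θ : D.H ≃ₐ[ℚ] D.H) (Q : APoint D.H) :
    φH D (thetaPt D θ Q) = thetaPtE D θ (φH D Q) := by
  rw [thetaPt, thetaPtE, φH, ← map_twoIsogenyPointsHom]

/-- If `θ(i) = −i` then `θ ∘ [i] = [−i] ∘ θ = −[i] ∘ θ` on `A(ℍ′_n)` (`[i](X, Y) = (−X, iY)`; the CM action is
defined over `ℚ(i)`). [cite: TianYuanZhang2017, §3.1 (p0011 L66)] -/
theorem thetaPt_iPt (D : GenusPointData n) (θ : D.H ≃ₐ[ℚ] D.H) (hθi : θ D.im = -D.im) (Q : APoint D.H) :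
    thetaPt D θ (D.iPt Q) = -D.iPt (thetaPt D θ Q) := by
  rcases Q with _ | ⟨x, y, h⟩
  · show thetaPt D θ (D.iPt 0) = -D.iPt (thetaPt D θ 0)
    simp only [map_zero, neg_zero]
  · change Point.map θ.toAlgHom (cmI D.im D.im_sq (.some x y h)) =
      -cmI D.im D.im_sq (Point.map θ.toAlgHom (.some x y h))
    rw [cmI_some, Point.map_some, Point.map_some, cmI_some, Point.neg_some]
    obtain ⟨h1, -, h3, -, -⟩ := curveA_baseChange_a (H := D.H)
    have hi : (θ.toAlgHom : D.H → D.H) D.im = -D.im := hθi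
    simp only [Point.some.injEq, negY, h1, h3, map_neg, map_mul, hi]
    exact ⟨trivial, by ring⟩

/-- `θ ∘ [i]^k = (−1)^k · [i]^k ∘ θ` when `θ(i) = −i`. [cite: TianYuanZhang2017, §3.1 (p0011 L66) and Thm. 3.3 (ε ∈ μ₄, p0011 L49–L51)] -/
theorem thetaPt_cmIPow (D : GenusPointData n) (θ : D.H ≃ₐ[ℚ] D.H) (hθi : θ D.im = -D.im) (k : ℕ)
    (Q : APoint D.H) :
    thetaPt D θ (cmIPow D.im D.im_sq k Q) = ((-1 : ℤ) ^ k) • cmIPow D.im D.im_sq k (thetaPt D θ Q) := by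
  induction k generalizing Q with
  | zero => simp [cmIPow]
  | succ k ih =>
    show thetaPt D θ (D.iPt (cmIPow D.im D.im_sq k Q)) = ((-1 : ℤ) ^ (k + 1)) • D.iPt (cmIPow D.im D.im_sq k (thetaPt D θ Q))
    rw [thetaPt_iPt D θ hθi, ih, map_zsmul, pow_succ, mul_neg_one, neg_smul]

/-- `[i]^k τ(1) = τ(1)`. [cite: TianYuanZhang2017, Lemma 3.16 (p0017 L105–L113)] -/
theorem cmIPow_tauOne (D : GenusPointData n) (k : ℕ) : cmIPow D.im D.im_sq k (tauOne : APoint D.H) = tauOne := by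
  induction k with
  | zero => rfl
  | succ k ih =>
    show D.iPt (cmIPow D.im D.im_sq k tauOne) = tauOne
    rw [ih, iPt_tauOne]

/-- `θ` fixes the rational points `τ(1) = (0,0)` and `τ(1/2) = (2,4)`. [cite: TianYuanZhang2017, §3.2 (p0012 L8–L18)] -/
theorem thetaPt_tauOne_tauHalf (D : GenusPointData n) (θ : D.H ≃ₐ[ℚ] D.H) :
    thetaPt D θ tauOne = tauOne ∧ thetaPt D θ tauHalf = tauHalf := by
  constructor
  · show Point.map θ.toAlgHom tauOne = tauOne
    rw [tauOne, Point.map_some]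
    simp only [map_zero]
  · show Point.map θ.toAlgHom tauHalf = tauHalf
    rw [tauHalf, Point.map_some]
    simp only [map_ofNat]

/-- `θ τ(i/2) = −τ(i/2)` when `θ(i) = −i` (`τ(i/2) = (−2, 4i)`). [cite: TianYuanZhang2017, §3.2 (p0012 L8–L18)] -/
theorem thetaPt_tauIHalf (D : GenusPointData n) (θ : D.H ≃ₐ[ℚ] D.H) (hθi : θ D.im = -D.im) :
    thetaPt D θ D.tauIHalf = -D.tauIHalf := by
  show thetaPt D θ (D.iPt tauHalf) = -D.iPt tauHalf
  rw [thetaPt_iPt D θ hθi, (thetaPt_tauOne_tauHalf D θ).2]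

/-- `θ ∘ ι_{K_n} = ι_{K_n}` on `K_n = GenusField n` when `θ(√−n) = √−n` (`θ ∈ Gal(ℍ′_n/K_n)`).
[cite: TianYuanZhang2017, §3.1 (p0011 L60–L64)] -/
theorem theta_comp_embK (D : GenusPointData n) (hn : n ∈ n.divisors) (θ : D.H ≃ₐ[ℚ] D.H)
    (hθK : θ (D.sqrtNeg n) = D.sqrtNeg n) : θ.toAlgHom.comp (D.embK n hn) = D.embK n hn := by
  apply AdjoinRoot.algHom_ext
  have h1 : (D.embK n hn) (AdjoinRoot.root (genusFieldPoly n)) = D.sqrtNeg n :=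
    AdjoinRoot.liftAlgHom_root _ _ _ _
  show θ.toAlgHom (D.embK n hn (AdjoinRoot.root (genusFieldPoly n))) = D.embK n hn (AdjoinRoot.root (genusFieldPoly n))
  rw [h1]
  exact hθK

/-- `θ` fixes the image of `A₂(K_n)` in `A₂(ℍ′_n)` when `θ(√−n) = √−n`. [cite: TianYuanZhang2017, §3.1 (p0011 L60–L64)] -/
theorem thetaPtE_map_embK (D : GenusPointData n) (hn : n ∈ n.divisors) (θ : D.H ≃ₐ[ℚ] D.H)
    (hθK : θ (D.sqrtNeg n) = D.sqrtNeg n) (γ : A2Point (GenusField n)) :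
    thetaPtE D θ (Point.map (W' := curveA.twoIsogenyCodomain) (D.embK n hn) γ) =
      Point.map (W' := curveA.twoIsogenyCodomain) (D.embK n hn) γ := by
  rw [thetaPtE, Point.map_map, theta_comp_embK D hn θ hθK]

end ThetaDescent

open ThetaDescent

/-! ## §2 The display: PROOF-B's `θ`-package (Lemma 4 (θ1)–(θ2), Lemma 5 (B0)–(B3)) on TYZ's genus-point data -/

/-- **The `θ`-package of PROOF-B on the Tian–Yuan–Zhang data `D` for `N = 2pq`** (`p ≡ 5 (mod 8)`, `q ≡ 3 (mod 4)`
primes): an automorphism `θ` of `ℍ′_N` — in PROOF-B, the restriction of any lift to `ℚ̄` of the GENERATOR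
`σ_{1+ϖ}` of `Gal(H′_N/H_N) ≅ ℤ/4` (TYZ Prop. 3.2 (2): `H′_N` = the ring class field of conductor `4` of
`K_N = ℚ(√−2pq)`) — such that
* (θ0) `θ ∈ Gal(ℍ′_N/K_N)`: `θ(√−N) = √−N`;
* (θ1) `θ(i) = −i` (class field theory: `σ_{1+ϖ}|_{ℚ^{ab}} = r₂(N(1+ϖ)) = r₂(1+N)`, `1 + N ≡ 7 (mod 8)`,
  `(7, −1)₂ = −1`; PROOF-B Lemma 4);
* (θ2) `θ` acts on `A(ℍ′_N)_tor = A[4]` (TYZ Lemma 3.18) as complex conjugation, in the form PROOF-B uses it: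
  `(θ − 1)A[4] ⊆ τ((i/2)ℤ) = ℤ·τ(i/2)` (`θ|_{ℚ(A[4]) = ℚ(i,√2)} = c` since `(7, 2)₂ = +1`; PROOF-B Lemma 3 (ii) /
  (T-c): `(c − 1)τ(x) = τ(x̄ − x)`, `x̄ − x ∈ (i/2)ℤ` for `x ∈ ¼(1+i)ℤ[i]`);
* (B0)+(B1) there is `w ∈ A(ℚ(i)) = A[(1+i)³]` (`2w ∈ {0, τ(1)}`) with `w + θ(w) = τ(1)` — in print
  `w = z_N^{σ_{1+ϖ}} − z_N = τ((1−i)/2)` (TYZ Thm. 3.6 (2)) — and `(θ − 1)Z(N) ∈ g(N)·w + ℤτ(1)`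
  (`Z(N) = Σ_{t ∈ Φ₀} z_N^t`, `#Φ₀ = g(N)`, `Gal(H′_N/K_N)` abelian; PROOF-B Lemma 5 (B0), (B1));
* (B2) `θ` FIXES the sub-block genus point: `Z(pq) ∈ A(L_{pq})`, `L_{pq} = ℚ(√p, √−q)` (`q ≡ 3 (mod 8)`), resp.
  `Z(q) ∈ A(K_q)` (`q ≡ 7 (mod 8)`), and `θ` fixes `√p`, `√−q` (`(7, p)₂ = +1`, `(7, q)₂ = −1`);
* (B3) (`q ≡ 3 (mod 8)`) `θ(Z(p)) ∈ −Z(p) + ℤτ(1)` (`θ|_{L_p} = c|_{L_p}`, `Gal(H′_p/L_p) = 2Cl′_p`, TYZ Thm. 3.6 (1):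
  `z̄_p = −z_p + τ(1)`, `z_p^{σ²_ϖ} = z_p + τ(1)`; PROOF-B Lemma 5 (B3)).
This is NOT a printed statement of [TianYuanZhang2017]: it is PROOF-B's Lemmas 4–5 (HOME/proof/PROOF-B.md §7,
refereed PASS 2026-08-25, HOME/REFEREE-VERDICT-B.md) read on the displayed data — the KERNEL DEBT `K_B` of route B
(its discharge = a display of TYZ Prop. 3.2 / Thm. 3.6 with the CM points `z_n` and the Artin map, plus Galois
bookkeeping; cf. the typer's `K1` for route A). A predicate; nothing asserted.
[cite: TianYuanZhang2017, Prop. 3.2 (p0010 L106–L115), Thm. 3.6 (p0012 L22–L36), Lemma 3.18 (p0017 L152–L153), §3.1 (p0011 L53–L66)] -/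
def thetaSpec {p q : ℕ} (D : GenusPointData (2 * (p * q))) (θ : D.H ≃ₐ[ℚ] D.H) : Prop :=
  θ (D.sqrtNeg (2 * (p * q))) = D.sqrtNeg (2 * (p * q)) ∧
  θ D.im = -D.im ∧
  (∀ t : APoint D.H, (4 : ℕ) • t = 0 → ∃ k : ℤ, thetaPt D θ t - t = k • D.tauIHalf) ∧
  (∃ w : APoint D.H, ((2 : ℕ) • w = 0 ∨ (2 : ℕ) • w = tauOne) ∧ thetaPt D θ w + w = tauOne ∧
    ∃ m : ℤ, thetaPt D θ (D.Z (2 * (p * q))) - D.Z (2 * (p * q)) = (gK (2 * (p * q)) : ℤ) • w + m • tauOne) ∧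
  (q % 8 = 3 → thetaPt D θ (D.Z (p * q)) = D.Z (p * q)) ∧
  (q % 8 = 7 → thetaPt D θ (D.Z q) = D.Z q) ∧
  (q % 8 = 3 → ∃ m : ℤ, thetaPt D θ (D.Z p) + D.Z p = m • tauOne)

/-- **Route B's ONE display (hypothesis package `K_B`) at the pair `(p, q)`**: there are Tian–Yuan–Zhang
genus-point data `D` for `N = 2pq` satisfying the displayed printed statements `D.Printed` (= the content of the tree's
named fact `tyz_genusPointData` at `n = 2pq`) TOGETHER WITH an automorphism `θ` of `ℍ′_N` satisfying PROOF-B's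
`θ`-package `thetaSpec D θ`. Used as the HYPOTHESIS "`∀ p q` prime, `p ≡ 5 (mod 8)`, `q ≡ 3 (mod 4)` →
`thetaGenusPointDatum p q`" (PROOF-B: `θ` = any lift of `σ_{1+ϖ}`; Lemmas 4–5 hold for every such pair, the
restriction to `𝒮⁻` enters only through `g(2pq)` odd). An obligation node (`@[conjecture]`: unproved in the tree) —
never a Literature fact (its source is the cell's refereed PROOF-B, not print); nothing asserted.
[cite: TianYuanZhang2017, §3 (Prop. 3.2, Thm. 3.5, Thm. 3.6, Lemma 3.18, Lemma 3.21)] -/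
@[conjecture] def thetaGenusPointDatum (p q : ℕ) : Prop :=
  ∃ D : GenusPointData (2 * (p * q)), D.Printed ∧ ∃ θ : D.H ≃ₐ[ℚ] D.H, thetaSpec D θ

end Summit.BirchSwinnertonDyer.Rank1Residual.P2

end
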